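import Summits.HodgeConjecture.HodgeConjecture.Theorems.Ring2HypothesesDescentMotivatedTranspose
import Summits.HodgeConjecture.HodgeConjecture.Theorems.Ring2HypothesesDescentMotivatedStarOperator
import Summits.HodgeConjecture.HodgeConjecture.Theorems.Ring2AbelianAllAndreCorrespondenceCategory
import HarnessLib

/-!
# Ring 2 hypotheses, descent face — THE KÜNNETH PROJECTORS ARE MOTIVATED (André Prop. 2.2 «π^j») and
# `B(X) ⟹ C(X)` (Kleiman): ONE homogeneous class of codimension `n` on `X ⊗ X` acting as the identity on `Hᵃ(X(ℂ))`
# and as zero on every other degree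

research route conditional on HC_CM; not a corollary; Q11.4-sentence-2 already refuted in dim ≥ 3.
Cell `pub-hodge-ring2` (Hodge ladder STAGE 3), seat `ring2-b05` (binder row b05
`Ring2.Hypotheses.MotivatedImpliesAlgebraicAV`), gen 36. `HC_CM` (`Theses.RankFourFaces.CMAbelianHodge`) does
not occur in this file; nothing here proves a case of the Hodge conjecture; rows b05 / b10 stay OPEN.

Kleiman 1968, §1.4 (1.4.4) and §2 (Cor. 2.5 «B(X) ⟹ C(X)»); André 1996 Prop. 2.2 («… les projecteurs … sont donnés par
des correspondances motivées»). A correspondence class `u ∈ H^{2e}((X ⊗ X)(ℂ))` acts on EVERY degree; the Künneth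
projector `π^a` is ONE class of codimension `n` whose action is `id` on `Hᵃ` and `0` on `H^{a'}`, `a' ≠ a`. This file runs
Kleiman's two-ended induction ABSTRACTLY, for any family `S e ⊆ H^{2e}((X ⊗ X)(ℂ))` of subspaces closed under uniform
composition, Lefschetz twists, the swap push-forward, containing the diagonal class and, for each `i ≤ n`, a class `θ_i`
of codimension `i` acting on `H^{2n-i}` as André's `*_η` (`= (L^{n-i})⁻¹` there) — `exists_degreeCutoffs_of_closed`:
the cut-off classes `Q_≥i` (acting as `[i ≤ a']·id`) and `Q^{≤2n-i}` (acting as `[a' + i ≤ 2n]·id`) exist in `S n` for all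
`i ≤ n + 1`, by `π^i = θ_i ∘ Q^{≤2n-i} ∘ [L^{n-i}] ∘ Q_≥i`, `π^{2n-i} = σ₊ π^i` (`…Transpose`), `Q_≥(i+1) = Q_≥i − π^i`,
`Q^{≤2n-i-1} = Q^{≤2n-i} − π^{2n-i}`; then `exists_kunnethProjector_of_closed` (`π^a = Q_≥a − Q_≥(a+1)`, resp.
`Q^{≤a} − Q^{≤a-1}`). Instances:

* **`exists_motivated_kunnethProjector`** — `S = A_mot(X ⊗ X)`: for EVERY smooth projective complex `X`, every
  orientation family and every `a`, there is `π ∈ A_motⁿ(X ⊗ X)_ℂ` with `[π]_* = id` on `Hᵃ(X(ℂ); ℂ)` and `[π]_* = 0` on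
  `H^{a'}(X(ℂ); ℂ)` for `a' ≠ a` (`θ_i` from Prop. 2.2, `lefschetzInvolution_mem_map_corrAction`; closure properties from
  `…TotalOperators` / `…Transpose`).
* **`exists_algebraic_kunnethProjector_of_standardConjectureBStar` — `B(X) ⟹ C(X)`**: `S = A(X ⊗ X)` (the coniveau spans of
  cycle classes), `θ_i` from `StandardConjectureBStar n X η` (complex orientation family, ab-andre-2's
  `IsAlgebraicCorrespondence.exists_eq_corrAction`).

No definition, no named fact, no sorry. References: Kleiman1968AlgebraicCycles (§1.4 Prop. 1.4.4, §2 Cor. 2.5, 2A11),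
Andre1996Motifs (Prop. 2.2 p. 16, §4), Grothendieck1968 (§3), Fulton1998 (§16.1).
-/

noncomputable section

-- every declaration of this problem lives in `Summit.HodgeConjecture.HodgeConjecture.…` (summit = sub-problem)
set_option linter.dupNamespace false

open CategoryTheory AlgebraicGeometry MonoidalCategory CartesianMonoidalCategory
open Literature.AlgebraicTopology.SingularHomology Literature.Geometry.Kaehler
open Literature.AlgebraicGeometry Literature.AlgebraicGeometry.Motives
  Literature.AlgebraicGeometry.HodgeTheory

namespace Summit.HodgeConjecture.HodgeConjecture.Theorems

variable (μ : OrientationFamily) {n : ℕ} {X : SchemeOver ℂ} {η : complexBetti X 2}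

/-! ## §1 Kleiman's two-ended induction, for a closed family of classes -/

/-- **The degree cut-offs `Q_≥i` and `Q^{≤2n-i}` are in `S n`** for every `i ≤ n + 1`, for a family `S` of subspaces
`S e ⊆ H^{2e}((X ⊗ X)(ℂ))` closed under uniform composition (`hcomp`), containing uniform Lefschetz powers `[Lʳ]`
(`hΛ`), the diagonal (`hδ`), stable under the swap push-forward (`hσ`), and containing for each `i ≤ n` a class `θ_i` of
codimension `i` acting on `H^{2n-i}` as `*_η` (`hθ`). Induction on `i`: `π^i = θ_i ∘ Q^{≤2n-i} ∘ [L^{n-i}] ∘ Q_≥i` acts as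
`[a' = i]·id` (degrees `a' < i` are cut below, degrees `a' > i` are pushed above `2n - i` by `L^{n-i}` and cut, and on
`Hⁱ` the composite is `*_η ∘ L^{n-i} = id`), `σ₊ π^i` acts as `[a' = 2n-i]·id` (`…Transpose`), and
`Q_≥(i+1) = Q_≥i − π^i`, `Q^{≤2n-i-1} = Q^{≤2n-i} − σ₊ π^i`. [cite: Kleiman1968AlgebraicCycles, §1.4 Prop. 1.4.4]
[cite: Andre1996Motifs, Prop. 2.2 (p. 16)] -/
theorem exists_degreeCutoffs_of_closed (hX : IsSmoothProjective n X) (hL : HasHardLefschetzProperty η n)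
    (S : (e : ℕ) → Submodule ℂ (complexBetti (X ⊗ X) (2 * e)))
    (hcomp : ∀ {e e' e'' : ℕ} (_ : e + e' = e'' + n) {γ : complexBetti (X ⊗ X) (2 * e)}
      {γ' : complexBetti (X ⊗ X) (2 * e')}, γ ∈ S e → γ' ∈ S e' →
      ∃ γ'' ∈ S e'', ∀ {a a₁ a₂ : ℕ} (h₁ : a + 2 * e' = a₁ + 2 * n) (h₂ : a₁ + 2 * e = a₂ + 2 * n)
        (h₃ : a + 2 * e'' = a₂ + 2 * n),
        corrAction μ hX hX h₃ γ'' = corrAction μ hX hX h₂ γ ∘ₗ corrAction μ hX hX h₁ γ')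
    (hΛ : ∀ r : ℕ, ∃ Λ ∈ S (n + r), ∀ {a₁ a₂ : ℕ} (h12 : a₁ + 2 * r = a₂) (h : a₁ + 2 * (n + r) = a₂ + 2 * n),
      corrAction μ hX hX h Λ = lefschetzPowTo η r a₁ a₂ h12)
    (hδ : ∃ δ ∈ S n, ∀ a : ℕ, corrAction μ hX hX (rfl : a + 2 * n = a + 2 * n) δ = LinearMap.id)
    (hσ : ∀ {γ : complexBetti (X ⊗ X) (2 * n)}, γ ∈ S n →
      complexGysin μ (IsSmoothProjective.tensor_holds hX hX) (IsSmoothProjective.tensor_holds hX hX) (β_ X X).hom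
        (rfl : 2 * n + 2 * (n + n) = 2 * n + 2 * (n + n)) γ ∈ S n)
    (hθ : ∀ (i b : ℕ), i + b = 2 * n → i ≤ n → ∃ θ ∈ S i, ∀ (h : b + 2 * i = i + 2 * n) (h' : b + i = 2 * n),
      corrAction μ hX hX h θ = lefschetzInvolution hL h') :
    ∀ i ≤ n + 1,
      (∃ Q ∈ S n, ∀ a : ℕ, corrAction μ hX hX (rfl : a + 2 * n = a + 2 * n) Q =
          if i ≤ a then LinearMap.id else 0) ∧
      (∃ Q ∈ S n, ∀ a : ℕ, corrAction μ hX hX (rfl : a + 2 * n = a + 2 * n) Q =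
          if a + i ≤ 2 * n then LinearMap.id else 0) := by
  intro i
  induction i with
  | zero =>
    intro _
    obtain ⟨δ, hδS, hδa⟩ := hδ
    refine ⟨⟨δ, hδS, fun a ↦ by rw [hδa, if_pos (Nat.zero_le a)]⟩, ⟨δ, hδS, fun a ↦ ?_⟩⟩
    by_cases ha : a + 0 ≤ 2 * n
    · rw [hδa, if_pos ha]
    · haveI := subsingleton_complexBetti hX (show 2 * n < a by omega)
      exact LinearMap.ext fun x ↦ Subsingleton.elim _ _
  | succ i ih =>
    intro hi1
    have hi : i ≤ n := by omega
    obtain ⟨⟨Ql, hQlS, hQl⟩, ⟨Qh, hQhS, hQh⟩⟩ := ih (by omega)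
    obtain ⟨r, hr⟩ : ∃ r, i + r = n := ⟨n - i, by omega⟩
    obtain ⟨θ, hθS, hθa⟩ := hθ i (i + 2 * r) (by omega) hi
    obtain ⟨Λ, hΛS, hΛa⟩ := hΛ r
    -- `π = θ ∘ Qh ∘ Λ ∘ Ql`
    obtain ⟨γ₁, hγ₁S, hγ₁⟩ := hcomp (e := n + r) (e' := n) (e'' := n + r) (by omega) hΛS hQlS
    obtain ⟨γ₂, hγ₂S, hγ₂⟩ := hcomp (e := n) (e' := n + r) (e'' := n + r) (by omega) hQhS hγ₁S
    obtain ⟨π, hπS, hπ⟩ := hcomp (e := i) (e' := n + r) (e'' := n) (by omega) hθS hγ₂S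
    -- the action of `π`: `[a = i] · id`
    have hπa : ∀ a : ℕ, corrAction μ hX hX (rfl : a + 2 * n = a + 2 * n) π =
        if a = i then LinearMap.id else 0 := by
      intro a
      rw [hπ (a₁ := a + 2 * r) (by omega) (by omega) rfl,
        hγ₂ (a₁ := a + 2 * r) (by omega) rfl (by omega),
        hγ₁ (a₁ := a) rfl (by omega) (by omega), hQl a, hQh (a + 2 * r), hΛa rfl (by omega)]
      rcases lt_trichotomy a i with hlt | heq | hgt
      · have h1 : ¬ i ≤ a := by omega
        have h2 : ¬ a = i := by omega
        rw [if_neg h1, if_neg h2, LinearMap.comp_zero, LinearMap.comp_zero, LinearMap.comp_zero]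
      · subst heq
        have h1 : a ≤ a := le_rfl
        have h2 : a + 2 * r + a ≤ 2 * n := by omega
        rw [if_pos h1, if_pos h2, if_pos rfl, LinearMap.comp_id, LinearMap.id_comp, hθa (by omega) (by omega)]
        refine LinearMap.ext fun x ↦ ?_
        rw [LinearMap.comp_apply, LinearMap.id_apply,
          lefschetzInvolution_lefschetzPowTo_eq hL (show a + r + 0 = n by omega) rfl (by omega)
            (show a + 2 * 0 = a by omega) x, lefschetzPowTo_zero_apply]
      · have h1 : i ≤ a := by omega
        have h2 : ¬ a + 2 * r + i ≤ 2 * n := by omega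
        have h3 : ¬ a = i := by omega
        rw [if_pos h1, if_neg h2, if_neg h3, LinearMap.zero_comp, LinearMap.comp_zero]
    -- the action of `σ₊ π`: `[a + i = 2n] · id`
    have hπt : ∀ a : ℕ, corrAction μ hX hX (rfl : a + 2 * n = a + 2 * n)
        (complexGysin μ (IsSmoothProjective.tensor_holds hX hX) (IsSmoothProjective.tensor_holds hX hX) (β_ X X).hom
          (rfl : 2 * n + 2 * (n + n) = 2 * n + 2 * (n + n)) π) =
        if a + i = 2 * n then LinearMap.id else 0 := by
      intro a
      by_cases hai : a + i = 2 * n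
      · rw [if_pos hai, corrAction_braiding_eq_smul_id μ hX (show i + a = 2 * n by omega) π
          (by rw [hπa i, if_pos rfl]), Even.neg_one_pow ⟨i * a, by ring⟩, one_smul]
      · rw [if_neg hai]
        by_cases ha : a ≤ 2 * n
        · obtain ⟨a₀, ha₀⟩ : ∃ a₀, a₀ + a = 2 * n := ⟨2 * n - a, by omega⟩
          exact corrAction_braiding_eq_zero μ hX (e := n) (rfl : a₀ + 2 * n = a₀ + 2 * n) ha₀ rfl π
            (by rw [hπa a₀, if_neg (by omega)])
        · haveI := subsingleton_complexBetti hX (show 2 * n < a by omega)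
          exact LinearMap.ext fun x ↦ Subsingleton.elim _ _
    refine ⟨⟨Ql - π, Submodule.sub_mem _ hQlS hπS, fun a ↦ ?_⟩,
      ⟨Qh - complexGysin μ (IsSmoothProjective.tensor_holds hX hX) (IsSmoothProjective.tensor_holds hX hX)
        (β_ X X).hom (rfl : 2 * n + 2 * (n + n) = 2 * n + 2 * (n + n)) π,
        Submodule.sub_mem _ hQhS (hσ hπS), fun a ↦ ?_⟩⟩
    · rw [map_sub, hQl a, hπa a]
      rcases lt_trichotomy a i with hlt | heq | hgt
      · have h1 : ¬ i ≤ a := by omega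
        have h2 : ¬ a = i := by omega
        have h3 : ¬ i + 1 ≤ a := by omega
        rw [if_neg h1, if_neg h2, if_neg h3, sub_zero]
      · have h1 : i ≤ a := by omega
        have h3 : ¬ i + 1 ≤ a := by omega
        rw [if_pos h1, if_pos heq, if_neg h3, sub_self]
      · have h1 : i ≤ a := by omega
        have h2 : ¬ a = i := by omega
        have h3 : i + 1 ≤ a := by omega
        rw [if_pos h1, if_neg h2, if_pos h3, sub_zero]
    · rw [map_sub, hQh a, hπt a]
      rcases lt_trichotomy (a + i) (2 * n) with hlt | heq | hgt
      · have h1 : a + i ≤ 2 * n := by omega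
        have h2 : ¬ a + i = 2 * n := by omega
        have h3 : a + (i + 1) ≤ 2 * n := by omega
        rw [if_pos h1, if_neg h2, if_pos h3, sub_zero]
      · have h1 : a + i ≤ 2 * n := by omega
        have h3 : ¬ a + (i + 1) ≤ 2 * n := by omega
        rw [if_pos h1, if_pos heq, if_neg h3, sub_self]
      · have h1 : ¬ a + i ≤ 2 * n := by omega
        have h2 : ¬ a + i = 2 * n := by omega
        have h3 : ¬ a + (i + 1) ≤ 2 * n := by omega
        rw [if_neg h1, if_neg h2, if_neg h3, sub_zero]

/-- **Künneth projectors in a closed family** (consequence of `exists_degreeCutoffs_of_closed`): for every `a` there is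
`π ∈ S n` with `[π]_* = id` on `Hᵃ(X(ℂ))` and `[π]_* = 0` on `H^{a'}(X(ℂ))`, `a' ≠ a` — `π^a = Q_≥a − Q_≥(a+1)` for `a ≤ n`,
`π^a = Q^{≤a} − Q^{≤a-1}` for `n < a ≤ 2n`, and `π^a = 0` above `2n`. [cite: Kleiman1968AlgebraicCycles, §1.4 Prop. 1.4.4]
[cite: Andre1996Motifs, Prop. 2.2 (p. 16)] -/
theorem exists_kunnethProjector_of_closed (hX : IsSmoothProjective n X) (hL : HasHardLefschetzProperty η n)
    (S : (e : ℕ) → Submodule ℂ (complexBetti (X ⊗ X) (2 * e)))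
    (hcomp : ∀ {e e' e'' : ℕ} (_ : e + e' = e'' + n) {γ : complexBetti (X ⊗ X) (2 * e)}
      {γ' : complexBetti (X ⊗ X) (2 * e')}, γ ∈ S e → γ' ∈ S e' →
      ∃ γ'' ∈ S e'', ∀ {a a₁ a₂ : ℕ} (h₁ : a + 2 * e' = a₁ + 2 * n) (h₂ : a₁ + 2 * e = a₂ + 2 * n)
        (h₃ : a + 2 * e'' = a₂ + 2 * n),
        corrAction μ hX hX h₃ γ'' = corrAction μ hX hX h₂ γ ∘ₗ corrAction μ hX hX h₁ γ')
    (hΛ : ∀ r : ℕ, ∃ Λ ∈ S (n + r), ∀ {a₁ a₂ : ℕ} (h12 : a₁ + 2 * r = a₂) (h : a₁ + 2 * (n + r) = a₂ + 2 * n),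
      corrAction μ hX hX h Λ = lefschetzPowTo η r a₁ a₂ h12)
    (hδ : ∃ δ ∈ S n, ∀ a : ℕ, corrAction μ hX hX (rfl : a + 2 * n = a + 2 * n) δ = LinearMap.id)
    (hσ : ∀ {γ : complexBetti (X ⊗ X) (2 * n)}, γ ∈ S n →
      complexGysin μ (IsSmoothProjective.tensor_holds hX hX) (IsSmoothProjective.tensor_holds hX hX) (β_ X X).hom
        (rfl : 2 * n + 2 * (n + n) = 2 * n + 2 * (n + n)) γ ∈ S n)
    (hθ : ∀ (i b : ℕ), i + b = 2 * n → i ≤ n → ∃ θ ∈ S i, ∀ (h : b + 2 * i = i + 2 * n) (h' : b + i = 2 * n),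
      corrAction μ hX hX h θ = lefschetzInvolution hL h')
    (a : ℕ) :
    ∃ π ∈ S n, ∀ a' : ℕ, corrAction μ hX hX (rfl : a' + 2 * n = a' + 2 * n) π =
      if a' = a then LinearMap.id else 0 := by
  have hcut := exists_degreeCutoffs_of_closed μ hX hL S hcomp hΛ hδ hσ hθ
  by_cases han : a ≤ n
  · obtain ⟨Q₁, hQ₁S, hQ₁⟩ := (hcut a (by omega)).1
    obtain ⟨Q₂, hQ₂S, hQ₂⟩ := (hcut (a + 1) (by omega)).1
    refine ⟨Q₁ - Q₂, Submodule.sub_mem _ hQ₁S hQ₂S, fun a' ↦ ?_⟩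
    rw [map_sub, hQ₁ a', hQ₂ a']
    rcases lt_trichotomy a' a with hlt | heq | hgt
    · have h1 : ¬ a ≤ a' := by omega
      have h2 : ¬ a + 1 ≤ a' := by omega
      have h3 : ¬ a' = a := by omega
      rw [if_neg h1, if_neg h2, if_neg h3, sub_zero]
    · have h1 : a ≤ a' := by omega
      have h2 : ¬ a + 1 ≤ a' := by omega
      rw [if_pos h1, if_neg h2, if_pos heq, sub_zero]
    · have h1 : a ≤ a' := by omega
      have h2 : a + 1 ≤ a' := by omega
      have h3 : ¬ a' = a := by omega
      rw [if_pos h1, if_pos h2, if_neg h3, sub_self]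
  by_cases ha2 : a ≤ 2 * n
  · obtain ⟨i, hi⟩ : ∃ i, a + i = 2 * n := ⟨2 * n - a, by omega⟩
    obtain ⟨Q₁, hQ₁S, hQ₁⟩ := (hcut i (by omega)).2
    obtain ⟨Q₂, hQ₂S, hQ₂⟩ := (hcut (i + 1) (by omega)).2
    refine ⟨Q₁ - Q₂, Submodule.sub_mem _ hQ₁S hQ₂S, fun a' ↦ ?_⟩
    rw [map_sub, hQ₁ a', hQ₂ a']
    rcases lt_trichotomy a' a with hlt | heq | hgt
    · have h1 : a' + i ≤ 2 * n := by omega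
      have h2 : a' + (i + 1) ≤ 2 * n := by omega
      have h3 : ¬ a' = a := by omega
      rw [if_pos h1, if_pos h2, if_neg h3, sub_self]
    · have h1 : a' + i ≤ 2 * n := by omega
      have h2 : ¬ a' + (i + 1) ≤ 2 * n := by omega
      rw [if_pos h1, if_neg h2, if_pos heq, sub_zero]
    · have h1 : ¬ a' + i ≤ 2 * n := by omega
      have h2 : ¬ a' + (i + 1) ≤ 2 * n := by omega
      have h3 : ¬ a' = a := by omega
      rw [if_neg h1, if_neg h2, if_neg h3, sub_zero]
  · refine ⟨0, Submodule.zero_mem _, fun a' ↦ ?_⟩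
    rw [map_zero]
    split_ifs with h
    · subst h
      haveI := subsingleton_complexBetti hX (show 2 * n < a' by omega)
      exact LinearMap.ext fun x ↦ Subsingleton.elim _ _
    · rfl

/-! ## §2 The Künneth projectors are MOTIVATED -/

/-- **André Prop. 2.2 «π^j»: the Künneth projectors are motivated, for every smooth projective complex `X`.** For
every orientation family `μ` and every degree `a` there is a MOTIVATED class `π ∈ A_motⁿ(X ⊗ X)_ℂ` with `[π]_* = id` on
`Hᵃ(X(ℂ); ℂ)` and `[π]_* = 0` on every other degree. `S = A_mot(X ⊗ X)`: uniform composition and twists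
(`…TotalOperators`), swap push-forward (`…Transpose`), the diagonal (algebraic ⊆ motivated, polarisation `η ⊞ η` of
`X ⊗ X`), and `θ_i` = the motivated class of `*_η : H^{2n-i} → Hⁱ` (`lefschetzInvolution_mem_map_corrAction`); a
polarisation `η` of `X` exists (`nonempty_hardLefschetzNFold_holds`). [cite: Andre1996Motifs, Prop. 2.2 (p. 16)]
[cite: Kleiman1968AlgebraicCycles, §1.4 Prop. 1.4.4] -/
theorem exists_motivated_kunnethProjector (hX : IsSmoothProjective n X) (a : ℕ) :
    ∃ π ∈ motivatedClasses (n + n) (X ⊗ X) n, ∀ a' : ℕ,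
      corrAction μ hX hX (rfl : a' + 2 * n = a' + 2 * n) π = if a' = a then LinearMap.id else 0 := by
  obtain ⟨Λ₀⟩ := nonempty_hardLefschetzNFold_holds n X hX
  have hη : IsPolarizationClass n X Λ₀.hyperplaneClass := Λ₀.isPolarizationClass
  have hXX : IsSmoothProjective (n + n) (X ⊗ X) := IsSmoothProjective.tensor_holds hX hX
  have hΘ := isPolarizationClass_boxSum hX hX hη hη
  have hδalg := (corrAction_diagonalClass μ hX 0).1
  have hδmot : _ ∈ motivatedClasses (n + n) (X ⊗ X) n :=
    algebraicClasses_le_motivatedClasses_of_isPolarizationClass hXX hΘ n hδalg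
  refine exists_kunnethProjector_of_closed μ hX hη.hasHardLefschetz (fun e ↦ motivatedClasses (n + n) (X ⊗ X) e)
    ?_ ?_ ⟨_, hδmot, fun a' ↦ (corrAction_diagonalClass μ hX a').2⟩ ?_ ?_ a
  · intro e e' e'' he γ γ' hγ hγ'
    obtain ⟨γ'', hmot, -, hact⟩ := exists_corrCompClass_total μ hX hX hX he γ γ'
    exact ⟨γ'', hmot hγ hγ', hact⟩
  · intro r
    obtain ⟨Λ, hmot, -, hact⟩ := exists_twistClass_total μ hX hX hη.mem_algebraicClasses r (rfl : n + r = n + r)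
      (complexGysin μ hX (IsSmoothProjective.tensor_holds hX hX) (lift (𝟙 X) (𝟙 X))
        (show 0 + 2 * (n + n) = 2 * n + 2 * n by omega) (singularCohomology.one ℂ (ComplexPoints X)))
    refine ⟨Λ, hmot hδmot, fun h12 h ↦ ?_⟩
    rw [hact h12 rfl h, (corrAction_diagonalClass μ hX _).2, LinearMap.id_comp]
  · intro γ hγ
    exact complexGysin_braiding_mem_motivatedClasses μ hX hγ
  · intro i b hib hi
    obtain ⟨θ, hθ, hact⟩ := lefschetzInvolution_mem_map_corrAction μ hX hη (show b + i = 2 * n by omega)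
    exact ⟨θ, hθ, fun h h' ↦ hact⟩

/-! ## §3 `B(X) ⟹ C(X)`: under the Lefschetz standard conjecture the Künneth projectors are algebraic -/

/-- **Kleiman: `B(X) ⟹ C(X)` on the real carriers.** If `StandardConjectureBStar n X η` holds for a polarisation class
`η` of the smooth projective complex `X`, then for every degree `a` there is an ALGEBRAIC class
`π ∈ Nⁿ H²ⁿ((X ⊗ X)(ℂ); ℂ)` with `[π]_* = id` on `Hᵃ(X(ℂ); ℂ)` and `[π]_* = 0` on every other degree (complex orientation
family): `S = A(X ⊗ X)`, `θ_i` the algebraic class of `*_η : H^{2n-i} → Hⁱ` given by `B` (ab-andre-2's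
`IsAlgebraicCorrespondence.exists_eq_corrAction`). [cite: Kleiman1968AlgebraicCycles, §1.4 Prop. 1.4.4 and §2 Cor. 2.5]
[cite: Grothendieck1968, §3 p. 196 (B(X), C(X))] -/
theorem exists_algebraic_kunnethProjector_of_standardConjectureBStar (hX : IsSmoothProjective n X)
    (hη : IsPolarizationClass n X η) (hB : StandardConjectureBStar n X η) (a : ℕ) :
    ∃ π ∈ algebraicClasses (X ⊗ X) n, ∀ a' : ℕ,
      corrAction complexOrientationFamily hX hX (rfl : a' + 2 * n = a' + 2 * n) π =
        if a' = a then LinearMap.id else 0 := by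
  have hXX : IsSmoothProjective (n + n) (X ⊗ X) := IsSmoothProjective.tensor_holds hX hX
  have hμ : complexOrientationFamily.HasPoincareDuality := OrientationFamily.hasPoincareDuality _
  have hδalg := (corrAction_diagonalClass complexOrientationFamily hX 0).1
  refine exists_kunnethProjector_of_closed complexOrientationFamily hX hη.hasHardLefschetz
    (fun e ↦ algebraicClasses (X ⊗ X) e) ?_ ?_
    ⟨_, hδalg, fun a' ↦ (corrAction_diagonalClass complexOrientationFamily hX a').2⟩ ?_ ?_ a
  · intro e e' e'' he γ γ' hγ hγ'
    obtain ⟨γ'', -, halg, hact⟩ := exists_corrCompClass_total complexOrientationFamily hX hX hX he γ γ'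
    exact ⟨γ'', halg hγ hγ', hact⟩
  · intro r
    obtain ⟨Λ, -, halg, hact⟩ := exists_twistClass_total complexOrientationFamily hX hX hη.mem_algebraicClasses r
      (rfl : n + r = n + r)
      (complexGysin complexOrientationFamily hX (IsSmoothProjective.tensor_holds hX hX) (lift (𝟙 X) (𝟙 X))
        (show 0 + 2 * (n + n) = 2 * n + 2 * n by omega) (singularCohomology.one ℂ (ComplexPoints X)))
    refine ⟨Λ, halg hδalg, fun h12 h ↦ ?_⟩
    rw [hact h12 rfl h, (corrAction_diagonalClass complexOrientationFamily hX _).2, LinearMap.id_comp]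
  · intro γ hγ
    exact CoreSplittingLadder.complexGysin_braiding_mem_algebraicClasses complexOrientationFamily hμ hXX rfl hγ
  · intro i b hib hi
    obtain ⟨e, hab, θ, hθ, hact⟩ := Ring2.AbelianAll.IsAlgebraicCorrespondence.exists_eq_corrAction hX hX
      (hB hη b i (show b + i = 2 * n by omega))
    obtain rfl : e = i := by omega
    exact ⟨θ, hθ, fun h h' ↦ hact.symm⟩

end Summit.HodgeConjecture.HodgeConjecture.Theorems

end
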